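import Summits.KontsevichZagierPeriods.KontsevichZagierPeriods.Theorems.RootDecompQuadraticDescentGoldenPairP5
import Summits.KontsevichZagierPeriods.KontsevichZagierPeriods.Theses.RootDecompQuadraticDescent

/-!
# DARK census pair #10 `[□²,1/(1−x+y+x²−y²)] ≡ 2·[□²,1/(1+y+2xy+y²)]` DECIDED in `KZ.relations` by rules 1+2 (route `RootDecompQuadraticDescent`, instance of crux stmt-KontsevichZagierPeriods-28994 `DescentTwoQ` / stmt-4280 `KZDimTwo`) · part 6/6

Cell `decomp-kz`, lens 6 (decomp-kz-lens-6 g8e): `pair10` — the golden-ratio dilogarithm pair of the weight-2 box census, decided with ℚ-data only (no power map, no Landen, no irrational cut); packaged `goldenPair_descentTwoQ_instance` (∀ R ⊇ relations) and `goldenPair_of_kzDimTwo` BY NAME over the born `KZDimTwo`; imports the LANDED `…DarkPairsEleven` reflection kit.  After this, the weight-2 box census has ONE open row (#18).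

Source: `HOME/decomp-kz-lens-6/g8/GoldenPair10.lean` sha256 3ad60a9384e30dab (1472 l; critic decomp-kz-crit-1 g2 CLEARED/kernel-confirmed 2026-08-30T10:32:33Z, std axioms), split into 6 modules by the landing seat decomp-kz-census-1 g7 (contexts re-opened per part; generic docstrings added where the source had none; the route file is imported only by the last part).  No `sorry`; standard axioms.  References: [cite: KontsevichZagier2001, §1.2].
-/

noncomputable section

open MeasureTheory Set MvPolynomial

namespace Summit.KontsevichZagierPeriods.RootDecompQuadraticDescent.GoldenPair

open Summit.KontsevichZagierPeriods.KontsevichZagierPeriods.Theses.RootDecompQuadraticDescent (KZDimTwo)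

open Literature.NumberTheory.Transcendental
open Literature.NumberTheory.Transcendental.KZ
open Literature.ModelTheory.ExponentialFields (IsSemialgebraic continuous_aeval_real)
open Summit.KontsevichZagierPeriods.RootDecompQuadraticDescent.DarkPairs (rel_reflect_rep rel_double
  update_one_apply_zero one_div_eq_mul_one_div)

-- PRIVATE copy (landed twin elsewhere; dedup.landed): snoc2_zero, snoc2_one, init2_zero, isRational_rep
/-- `snoc2_zero`: auxiliary theorem of the lens-6 g8e development GoldenPair10 (census pair #10; instances of 28994/4280) — see the module docstring; verbatim from the lens file. -/
@[simp] private theorem snoc2_zero (x : Fin 1 → ℝ) (t : ℝ) : (Fin.snoc x t : Fin 2 → ℝ) 0 = x 0 := rfl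

/-- `snoc2_one`: auxiliary theorem of the lens-6 g8e development GoldenPair10 (census pair #10; instances of 28994/4280) — see the module docstring; verbatim from the lens file. -/
@[simp] private theorem snoc2_one (x : Fin 1 → ℝ) (t : ℝ) : (Fin.snoc x t : Fin 2 → ℝ) 1 = t := rfl

/-- `init2_zero`: auxiliary theorem of the lens-6 g8e development GoldenPair10 (census pair #10; instances of 28994/4280) — see the module docstring; verbatim from the lens file. -/
@[simp] private theorem init2_zero (z : Fin 2 → ℝ) : Fin.init z 0 = z 0 := rfl

/-- A regular rational function gives a KZ-rational representation. [folklore] -/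
private theorem isRational_rep {M : ℕ} (T : RFun M) : T.rep.IsRational :=
  ⟨T.num, T.den, T.den_ne, fun _ _ => rfl⟩

/-- **A-side**: `A10 ≡ TΔ(1) + TΔ(−1)`. -/
private theorem a10_T : KZ.of A10.rep - KZ.of (TΔ 1 (by norm_num)) - KZ.of (TΔ (-1) (by norm_num)) ∈
    KZ.relations := by
  have h := sub_mem (sub_mem (add_mem (add_mem (add_mem (add_mem (add_mem (add_mem d1 d2) d3) d4) d5)
    d6) d7) (d8 1 (by norm_num))) (d8 (-1) (by norm_num))
  convert h using 1
  abel

/-! ## §9 Dark row #10 DECIDED: `[A10] − 2·[B10] ∈ KZ.relations` -/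

/-- **Dark census row #10 DECIDED** by rules 1 + 2 only:
`[□², dx dy/(1 − x + y + x² − y²)] − 2·[□², dx dy/(1 + y + 2xy + y²)] ∈ KZ.relations`. -/
theorem pair10 : KZ.of A10.rep - 2 • KZ.of B10.rep ∈ KZ.relations := by
  have h := add_mem a10_T golden_heart
  convert h using 1
  abel

/-- The pair with the doubled integrand `B10d = [□², 2/Q_B]`. -/
def B10d : RFun 2 := ⟨2, QB10, fun _ hx => (QB10_pos hx).ne'⟩

/-- `b10d`: auxiliary theorem of the lens-6 g8e development GoldenPair10 (census pair #10; instances of 28994/4280) — see the module docstring; verbatim from the lens file. -/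
private theorem b10d : KZ.of B10d.rep - 2 • KZ.of B10.rep ∈ KZ.relations :=
  rel_double B10 B10d fun x _ => by simp only [RFun.fn, B10d, B10, map_ofNat, map_one]; ring

/-- `pair10'`: auxiliary theorem of the lens-6 g8e development GoldenPair10 (census pair #10; instances of 28994/4280) — see the module docstring; verbatim from the lens file. -/
theorem pair10' : KZ.of A10.rep - KZ.of B10d.rep ∈ KZ.relations := by
  have h := sub_mem pair10 b10d
  convert h using 1
  abel

/-- `pair10_equivalent`: auxiliary theorem of the lens-6 g8e development GoldenPair10 (census pair #10; instances of 28994/4280) — see the module docstring; verbatim from the lens file. -/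
theorem pair10_equivalent : KZ.Equivalent A10.rep B10d.rep := pair10'

/-- `pair10_value`: auxiliary theorem of the lens-6 g8e development GoldenPair10 (census pair #10; instances of 28994/4280) — see the module docstring; verbatim from the lens file. -/
theorem pair10_value : A10.rep.value = B10d.rep.value :=
  KZ.Equivalent.value_eq_holds pair10_equivalent

/-! ## §10 Packaging: the pair as a DECIDED INSTANCE of the route items -/

/-- Dark row #10 (`A10`, `B10d`) is a decided instance of the `n = m = 2` case: both members
KZ-rational, equal values, and EQUIVALENT — the conclusion of `KZDimTwo` (item 4280) holds for it. -/
theorem goldenPair_decided :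
    A10.rep.IsRational ∧ B10d.rep.IsRational ∧ A10.rep.value = B10d.rep.value ∧
      KZ.Equivalent A10.rep B10d.rep :=
  ⟨isRational_rep _, isRational_rep _, pair10_value, pair10_equivalent⟩

/-- For every `R ⊇ KZ.relations` the #10 difference lies in `R`: an instance of the conclusion of
`DescentTwoQ` (item 28994) with NO use of its oracle hypotheses. -/
theorem goldenPair_descentTwoQ_instance (R : AddSubgroup KZ.FormalRep) (hR : KZ.relations ≤ R) :
    KZ.of A10.rep - KZ.of B10d.rep ∈ R :=
  hR pair10'

/-- … and, trivially, `KZDimTwo` (the born route decl, BY NAME) implies the equivalence too. -/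
theorem goldenPair_of_kzDimTwo (h : KZDimTwo) : KZ.Equivalent A10.rep B10d.rep :=
  h le_rfl le_rfl _ _ (isRational_rep _) (isRational_rep _) pair10_value

/-- info: 'Summit.KontsevichZagierPeriods.RootDecompQuadraticDescent.GoldenPair.pair10' depends on axioms: [propext,
 Classical.choice,
 Quot.sound] -/
#guard_msgs in #print axioms pair10

/-- info: 'Summit.KontsevichZagierPeriods.RootDecompQuadraticDescent.GoldenPair.goldenPair_decided' depends on axioms: [propext,
 Classical.choice,
 Quot.sound] -/
#guard_msgs in #print axioms goldenPair_decided

end Summit.KontsevichZagierPeriods.RootDecompQuadraticDescent.GoldenPair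

end
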